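import Summits.NavierStokesRegularity.NavierStokesRegularity.Theorems.QuantisedSymmetryPolyhedralDssProfileExistsDominatesBlowupProfile
import Summits.NavierStokesRegularity.NavierStokesRegularity.Theorems.DssFarFieldSlavingDssTruncationBridge
import HarnessLib

/-!
# Strategist s19-g14 — typed objects of the STRATEGY CENSUS for crux
`QuantisedSymmetry.PolyhedralDssProfileExists` (stmt-NavierStokesRegularity-1404).

Scratch file (planner folder only; nothing here is proposed to the tree). Each section of
`STRATEGY-CENSUS-s19.md` refers to the declarations below by name.
-/

open MeasureTheory
open Literature.Analysis.FluidPDE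

namespace Summit.NavierStokesRegularity.NavierStokesRegularity.Cruxes.PolyhedralDssProfileExists.StrategistS19g14

/-- the crux (verbatim route decl). -/
abbrev X : Prop :=
  _root_.Summit.NavierStokesRegularity.NavierStokesRegularity.Theses.QuantisedSymmetry.PolyhedralDssProfileExists

/-- the summit. -/
abbrev S : Prop := _root_.NavierStokesRegularity

/-! ## 1. Weaker intermediates (from the summit statement downwards) -/

/-- `X_a` = stmt-NavierStokesRegularity-0155 (`Blowup.BlowupTypeIDssProfile`): failure of Tsai's Type-I
(rotated) `λ`-DSS Liouville wall for SOME factor — the weakest typed statement in the tree that a re-glued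
`closes` of this route could consume (all other binders are theorems). -/
abbrev WeakerIntermediateA : Prop :=
  _root_.Summit.NavierStokesRegularity.NavierStokesRegularity.Theses.Blowup.BlowupTypeIDssProfile

/-- `X → X_a` (landed: `stub_dominatesBlowupProfile`, line `polyhedral_cell`, c15). -/
theorem weakerA_of_crux : X → WeakerIntermediateA :=
  _root_.Summit.NavierStokesRegularity.NavierStokesRegularity.Theorems.PolyhedralDssProfileExists.PolyhedralCell.stub_dominatesBlowupProfile

/-- `X_a → ¬ S` is ALREADY a composition of landed theorems: route DssFarFieldSlaving's deciding theorem
with its bridge binder discharged by `dssTruncationBridge_proof` (stmt-0901, via the sector-agnostic RDSS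
truncation bridge stmt-11289). Hence every statement between `X` and `¬ S` that the tree can consume is a
blow-up existence statement deciding the summit. -/
theorem not_summit_of_weakerA : WeakerIntermediateA → ¬ S := fun h =>
  _root_.Summit.NavierStokesRegularity.NavierStokesRegularity.Theses.DssFarFieldSlaving.closes
    _root_.Summit.NavierStokesRegularity.NavierStokesRegularity.Theorems.dssTruncationBridge_proof h

/-- the re-glued deciding theorem this route would have if `X` were replaced by `X_a`. -/
theorem closes_reglued_on_weakerA (hXa : WeakerIntermediateA) : ¬ S := not_summit_of_weakerA hXa

/-- `X_b`: the SECTOR-FREE λ-DSS Type-I profile (drop the three `G`-clauses of `X`). `X → X_b → X_a`. -/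
def SectorFreeDssProfileExists : Prop :=
  ∃ c : ℝ, 1 < c ∧ ∃ u : ℝ → EuclideanSpace ℝ (Fin 3) → EuclideanSpace ℝ (Fin 3),
    IsAncientMildSolution 1 u ∧ (∀ t < 0, AEStronglyMeasurable (u t) volume) ∧
      IsDiscretelySelfSimilar c u ∧ (∃ C₀ : ℝ, HasTypeIDecay C₀ u) ∧ ¬ (∀ t < 0, u t =ᵐ[volume] 0)

theorem sectorFree_of_crux : X → SectorFreeDssProfileExists := by
  rintro ⟨G, -, -, -, c, hc, u, hanc, hmeas, hdss, hdec, -, hnt⟩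
  exact ⟨c, hc, u, hanc, hmeas, hdss, hdec, hnt⟩

theorem weakerA_of_sectorFree : SectorFreeDssProfileExists → WeakerIntermediateA := by
  rintro ⟨c, hc, u, hanc, hmeas, hdss, hdec, hnt⟩
  dsimp only [WeakerIntermediateA,
    _root_.Summit.NavierStokesRegularity.NavierStokesRegularity.Theses.Blowup.BlowupTypeIDssProfile]
  exact fun hL => hnt ((hL c).1 hc u hanc hmeas hdss hdec)

/-! ## 2. Decompositions -/

/-- D1, piece 1 (∃-piece): a nontrivial `G`-equivariant λ-DSS ancient mild solution which is Type I IN TIME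
only (`‖u(t,x)‖ ≤ C₀/√(−t)`), no spatial decay asked. Strictly fewer constraints than `X`. -/
def PieceExistsTimeTypeI : Prop :=
  ∃ G : Subgroup (EuclideanSpace ℝ (Fin 3) ≃ₗᵢ[ℝ] EuclideanSpace ℝ (Fin 3)), Finite G ∧
    (∀ g ∈ G, LinearMap.det (g.toLinearEquiv : EuclideanSpace ℝ (Fin 3) →ₗ[ℝ] EuclideanSpace ℝ (Fin 3)) = 1) ∧
    (∀ V : Submodule ℝ (EuclideanSpace ℝ (Fin 3)), (∀ g ∈ G, ∀ v ∈ V, g v ∈ V) → V = ⊥ ∨ V = ⊤) ∧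
    ∃ c : ℝ, 1 < c ∧ ∃ u : ℝ → EuclideanSpace ℝ (Fin 3) → EuclideanSpace ℝ (Fin 3),
      IsAncientMildSolution 1 u ∧ (∀ t < 0, AEStronglyMeasurable (u t) volume) ∧
        IsDiscretelySelfSimilar c u ∧ (∃ C₀ : ℝ, HasTypeITimeDecay C₀ u) ∧
          (∀ g ∈ G, ∀ t x, u t (g x) = g (u t x)) ∧ ¬ (∀ t < 0, u t =ᵐ[volume] 0)

/-- D1, piece 2 (∀-piece, a far-field DECAY UPGRADE): every λ-DSS ancient mild solution that is Type I in
time has the space–time Type-I decay `‖u‖ ≤ C₁/(‖x‖+√(−t))` (equivalently: bounded `S`-periodic profiles of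
the Leray system decay like `1/|y|`). Lemma-sized in appearance; open as stated (the transport term is not
perturbative at infinity for a merely bounded profile). -/
def PieceDecayUpgrade : Prop :=
  ∀ c : ℝ, 1 < c → ∀ u : ℝ → EuclideanSpace ℝ (Fin 3) → EuclideanSpace ℝ (Fin 3),
    IsAncientMildSolution 1 u → (∀ t < 0, AEStronglyMeasurable (u t) volume) →
      IsDiscretelySelfSimilar c u → (∃ C₀ : ℝ, HasTypeITimeDecay C₀ u) → ∃ C₁ : ℝ, HasTypeIDecay C₁ u

/-- D1 assembly `X₁ → X₂ → X` (proved; the seam is modus ponens — informational flag `trivial_seam`). -/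
theorem crux_of_D1 : PieceExistsTimeTypeI → PieceDecayUpgrade → X := by
  rintro ⟨G, hfin, hdet, hirr, c, hc, u, hanc, hmeas, hdss, hdecT, heqv, hnt⟩ hup
  exact ⟨G, hfin, hdet, hirr, c, hc, u, hanc, hmeas, hdss, hup c hc u hanc hmeas hdss hdecT, heqv, hnt⟩

/-- D1, piece 1 is a CONSEQUENCE of `X` (so it is genuinely weaker-or-equal; it is not known to decide `S`:
without spatial decay no truncation bridge applies). -/
theorem pieceExists_of_crux : X → PieceExistsTimeTypeI := by
  rintro ⟨G, hfin, hdet, hirr, c, hc, u, hanc, hmeas, hdss, ⟨C₀, hdec⟩, heqv, hnt⟩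
  refine ⟨G, hfin, hdet, hirr, c, hc, u, hanc, hmeas, hdss, ⟨max C₀ 0, ?_⟩, heqv, hnt⟩
  intro t ht x
  have hsq : 0 < Real.sqrt (-t) := Real.sqrt_pos.mpr (by linarith)
  have hden : Real.sqrt (-t) ≤ ‖x‖ + Real.sqrt (-t) := by
    have := norm_nonneg x; linarith
  calc ‖u t x‖ ≤ C₀ / (‖x‖ + Real.sqrt (-t)) := hdec t ht x
    _ ≤ max C₀ 0 / (‖x‖ + Real.sqrt (-t)) :=
        div_le_div_of_nonneg_right (le_max_left _ _) (by linarith)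
    _ ≤ max C₀ 0 / Real.sqrt (-t) :=
        div_le_div_of_nonneg_left (le_max_right _ _) hsq hden

/-- D2 (certificate split), the ABSTRACT shape of the Newton–Kantorovich piece: an `(ε, K, L, r)`-certificate
for a `C¹` map `F` at `x₀` on a real Banach space. Piece N2 "certificate ⇒ zero of `F` in the ball" is a
THEOREM of analysis (Kantorovich 1948); piece N1 "a certificate exists for the periodic Leray map in the
`G`-sector" needs a numerical CANDIDATE `x₀` — none exists (see census §2). -/
def NKCertificate {E : Type*} [NormedAddCommGroup E] [NormedSpace ℝ E] (F : E → E) (x₀ : E)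
    (ε K L r : ℝ) : Prop :=
  0 ≤ ε ∧ 0 ≤ K ∧ 0 ≤ L ∧ 0 < r ∧ ‖F x₀‖ ≤ ε ∧
    (∃ A : E ≃L[ℝ] E, HasFDerivAt F (A : E →L[ℝ] E) x₀ ∧ ‖(A.symm : E →L[ℝ] E)‖ ≤ K) ∧
    (∀ x ∈ Metric.closedBall x₀ r, DifferentiableAt ℝ F x) ∧
    (∀ x ∈ Metric.closedBall x₀ r, ∀ y ∈ Metric.closedBall x₀ r,
        ‖fderiv ℝ F x - fderiv ℝ F y‖ ≤ L * ‖x - y‖) ∧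
    2 * K * ε ≤ r ∧ 2 * K * L * r ≤ 1

/-- N2 as a statement (Newton–Kantorovich; a known theorem, not a crux). -/
def NKTheoremShape : Prop :=
  ∀ (E : Type) [NormedAddCommGroup E] [NormedSpace ℝ E] [CompleteSpace E] (F : E → E) (x₀ : E)
    (ε K L r : ℝ), NKCertificate F x₀ ε K L r → ∃ x ∈ Metric.closedBall x₀ r, F x = 0

/-! ## 3. Strengthenings -/

/-- S⁺ (a FAMILY accumulating at `λ → 1⁺`): for every `ε > 0` a witness of `X` with factor `1 < c < 1+ε`.
By Pineau–Vicol Thm 1.6 (`λ̄(C₀) > 1`) the Type-I constants of such a family must blow up, `C₀(ε) → ∞`. -/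
def StrengthenedFamily : Prop :=
  ∀ ε : ℝ, 0 < ε →
    ∃ G : Subgroup (EuclideanSpace ℝ (Fin 3) ≃ₗᵢ[ℝ] EuclideanSpace ℝ (Fin 3)), Finite G ∧
      (∀ g ∈ G, LinearMap.det (g.toLinearEquiv : EuclideanSpace ℝ (Fin 3) →ₗ[ℝ] EuclideanSpace ℝ (Fin 3)) = 1) ∧
      (∀ V : Submodule ℝ (EuclideanSpace ℝ (Fin 3)), (∀ g ∈ G, ∀ v ∈ V, g v ∈ V) → V = ⊥ ∨ V = ⊤) ∧
      ∃ c : ℝ, 1 < c ∧ c < 1 + ε ∧ ∃ u : ℝ → EuclideanSpace ℝ (Fin 3) → EuclideanSpace ℝ (Fin 3),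
        IsAncientMildSolution 1 u ∧ (∀ t < 0, AEStronglyMeasurable (u t) volume) ∧
          IsDiscretelySelfSimilar c u ∧ (∃ C₀ : ℝ, HasTypeIDecay C₀ u) ∧
            (∀ g ∈ G, ∀ t x, u t (g x) = g (u t x)) ∧ ¬ (∀ t < 0, u t =ᵐ[volume] 0)

theorem crux_of_family : StrengthenedFamily → X := by
  intro h
  obtain ⟨G, hfin, hdet, hirr, c, hc, -, u, hanc, hmeas, hdss, hdec, heqv, hnt⟩ := h 1 one_pos
  exact ⟨G, hfin, hdet, hirr, c, hc, u, hanc, hmeas, hdss, hdec, heqv, hnt⟩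

/-! ## 4. Negation side -/

/-- the Liouville form of `¬ X` (what a counterexample-to-the-crux seat must prove): every `G`-equivariant
Type-I λ-DSS ancient mild solution is a.e. trivial, for every finite irreducible proper rotation group and
every `λ > 1`. Partial results: NRŠ 1996 / Tsai 1998 (steady profiles), Chae–Wolf 2017 and Pineau–Vicol 2026
Thm 1.6 (`1 < λ < λ̄(C₀)`), Thm 1.9 (`∂ₛU` small at one slice). -/
def PolyhedralDssLiouville : Prop :=
  ∀ G : Subgroup (EuclideanSpace ℝ (Fin 3) ≃ₗᵢ[ℝ] EuclideanSpace ℝ (Fin 3)), Finite G →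
    (∀ g ∈ G, LinearMap.det (g.toLinearEquiv : EuclideanSpace ℝ (Fin 3) →ₗ[ℝ] EuclideanSpace ℝ (Fin 3)) = 1) →
    (∀ V : Submodule ℝ (EuclideanSpace ℝ (Fin 3)), (∀ g ∈ G, ∀ v ∈ V, g v ∈ V) → V = ⊥ ∨ V = ⊤) →
    ∀ c : ℝ, 1 < c → ∀ u : ℝ → EuclideanSpace ℝ (Fin 3) → EuclideanSpace ℝ (Fin 3),
      IsAncientMildSolution 1 u → (∀ t < 0, AEStronglyMeasurable (u t) volume) →
        IsDiscretelySelfSimilar c u → (∃ C₀ : ℝ, HasTypeIDecay C₀ u) →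
          (∀ g ∈ G, ∀ t x, u t (g x) = g (u t x)) → ∀ t < 0, u t =ᵐ[volume] 0

theorem liouville_iff_not_crux : PolyhedralDssLiouville ↔ ¬ X := by
  constructor
  · rintro hL ⟨G, hfin, hdet, hirr, c, hc, u, hanc, hmeas, hdss, hdec, heqv, hnt⟩
    exact hnt (hL G hfin hdet hirr c hc u hanc hmeas hdss hdec heqv)
  · intro hX G hfin hdet hirr c hc u hanc hmeas hdss hdec heqv
    by_contra hnt
    exact hX ⟨G, hfin, hdet, hirr, c, hc, u, hanc, hmeas, hdss, hdec, heqv, hnt⟩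

/-- the sector-free Liouville wall (Tsai's conjecture at every factor) kills the crux outright. -/
theorem not_crux_of_tsai (hT : ∀ c : ℝ, TypeIDSSLiouville c) : ¬ X := by
  rintro ⟨G, -, -, -, c, hc, u, hanc, hmeas, hdss, hdec, -, hnt⟩
  exact hnt (hT c hc u hanc hmeas hdss hdec)

end Summit.NavierStokesRegularity.NavierStokesRegularity.Cruxes.PolyhedralDssProfileExists.StrategistS19g14
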